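import Literature.RingTheory.DiscreteValuationRing.AdicCompletionHensel
import HarnessLib

/-!
# Route `SignedLowerHalves`, crux L `SmallImageLowerHalfBothSigns` (stmt-BirchSwinnertonDyer-23599), line `rtt_w3` v12 — row T-2 / J-loc′ of INJ_top,
# local algebra: EVERY `𝒪_v`-LINEAR ENDOMORPHISM OF `K_v/𝒪_v` IS MULTIPLICATION BY AN ELEMENT OF `𝒪_v`

Hand `bsd-inputs-honda-p1` g20 (LEAD `cruxlead-stmt-BirchSwinnertonDyer-23599` g7); helper `--supports stmt-BirchSwinnertonDyer-23599`; THEOREMS ONLY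
(no definition, no named fact, no instance, no `sorry`).  BSD / crux L / INJ_top / T-2 are NOT proved here.

WHY.  In T-2 the coordinates `s_i : M → W_K[p^∞]` and the binder `j : W_K[p^∞] → M` are `𝒪_v`-linear, and the expansion identity `hexp` of
`…RttCharRoadE1LocalSatTransport` wants `s_i (r • j x) = u_b x` for a FORMAL-MODULE scalar `b ∈ 𝒪_v` (only those have the Kummer-stability `hstab`,
row B5-pts).  Through row J-curve's `α : W_K[p^∞] ≃ K_v/𝒪_v` this is the statement of this file: `End_{𝒪_v}(K_v/𝒪_v) = 𝒪_v`.

* ★ `exists_eq_smul_of_linear` — for `O = 𝒪_v = v.adicCompletionIntegers K`, `Q = K_v ⧸ 𝒪_v·1`, every additive `φ : Q → Q` with `φ (c • q) = c • φ q`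
  (`c ∈ 𝒪_v`) is `q ↦ c₀ • q` for some `c₀ ∈ 𝒪_v`.  Proof: with a uniformiser `ϖ`, `φ(ϖ⁻ⁿ) = yₙ` has `ϖⁿ yₙ =: cₙ ∈ 𝒪_v` (it is killed by `ϖⁿ`),
  `c_{n+1} ≡ cₙ (mod ϖⁿ)` (`ϖ · ϖ^{-(n+1)} = ϖ^{-n}`), so `(cₙ)` converges `𝔪`-adically (`IsAdicComplete`, tree `AdicCompletionHensel`) to `c₀`, and
  `φ(a ϖ⁻ⁿ) = a yₙ ≡ c₀ a ϖ⁻ⁿ (mod 𝒪_v)`; auxiliary `mem_span_adicCompletionIntegers_one_iff`, `exists_eq_mul_inv_pow` (`x = a ϖ⁻ⁿ`).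

References: [SerreLocalFields1979] Ch. II §1 (complete DVRs, `A = lim A/𝔪ⁿ`); [Matsumura1986] Thm. 18.6 (Matlis duality: `End(E(k)) = Â`) — here
the elementary rank-one case.
-/

set_option autoImplicit false
-- D-0017: single-problem summit, the namespace repeats the problem name by design.
set_option linter.dupNamespace false
noncomputable section

open scoped Classical NumberField
open NumberField IsDedekindDomain IsDedekindDomain.HeightOneSpectrum

namespace Summit.BirchSwinnertonDyer.BirchSwinnertonDyer.Theorems.SmallImageRttCharRoad

section DivisibleEnd

variable {K : Type*} [Field K] [NumberField K] (v : HeightOneSpectrum (𝓞 K))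

/-- Membership in `𝒪_v · 1 ⊆ K_v`: `x ∈ span 𝒪_v {1} ↔ x ∈ 𝒪_v`. [folklore] -/
theorem mem_span_adicCompletionIntegers_one_iff (x : v.adicCompletion K) :
    x ∈ Submodule.span (v.adicCompletionIntegers K) {(1 : v.adicCompletion K)} ↔ x ∈ v.adicCompletionIntegers K := by
  rw [Submodule.mem_span_singleton]
  constructor
  · rintro ⟨c, rfl⟩
    rw [Algebra.smul_def, mul_one]
    exact c.2
  · intro hx
    exact ⟨⟨x, hx⟩, by rw [Algebra.smul_def, mul_one]; rfl⟩

/-- Every `x ∈ K_v` is `a · ϖ⁻ⁿ` with `a ∈ 𝒪_v`, for a uniformiser `ϖ` (`K_v = Frac 𝒪_v`, `𝒪_v` a DVR). [cite: SerreLocalFields1979, Ch. II §1] -/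
theorem exists_eq_mul_inv_pow {ϖ : v.adicCompletionIntegers K} (hϖ : Irreducible ϖ) (x : v.adicCompletion K) :
    ∃ (n : ℕ) (a : v.adicCompletionIntegers K), x = (a : v.adicCompletion K) * ((ϖ : v.adicCompletion K)⁻¹) ^ n := by
  obtain ⟨a, b, hb, rfl⟩ := IsFractionRing.div_surjective (A := v.adicCompletionIntegers K) x
  have hb0 : b ≠ 0 := nonZeroDivisors.ne_zero hb
  obtain ⟨n, u, hu⟩ := IsDiscreteValuationRing.associated_pow_irreducible hb0 hϖ
  refine ⟨n, a * ↑u, ?_⟩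
  change (a : v.adicCompletion K) / (b : v.adicCompletion K) = _
  have hcoe0 : ∀ {z : v.adicCompletionIntegers K}, z ≠ 0 → (z : v.adicCompletion K) ≠ 0 :=
    fun {z} hz h ↦ hz (Subtype.ext h)
  have hu0 : ((u : v.adicCompletionIntegers K) : v.adicCompletion K) ≠ 0 := hcoe0 (Units.ne_zero u)
  have hϖ0 : (ϖ : v.adicCompletion K) ≠ 0 := hcoe0 hϖ.ne_zero
  have hbF : (b : v.adicCompletion K) * ((u : v.adicCompletionIntegers K) : v.adicCompletion K) = (ϖ : v.adicCompletion K) ^ n := by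
    have h := congrArg (fun z : v.adicCompletionIntegers K ↦ (z : v.adicCompletion K)) hu
    push_cast at h
    exact h
  calc (a : v.adicCompletion K) / (b : v.adicCompletion K)
      = (a : v.adicCompletion K) * ((u : v.adicCompletionIntegers K) : v.adicCompletion K) /
          ((b : v.adicCompletion K) * ((u : v.adicCompletionIntegers K) : v.adicCompletion K)) := by
        rw [mul_div_mul_right _ _ hu0]
    _ = ((a * ↑u : v.adicCompletionIntegers K) : v.adicCompletion K) * ((ϖ : v.adicCompletion K)⁻¹) ^ n := by
        rw [hbF, inv_pow, div_eq_mul_inv]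
        push_cast
        ring

/-- ★ **`End_{𝒪_v}(K_v/𝒪_v) = 𝒪_v`.** Every additive endomorphism `φ` of `Q = K_v ⧸ 𝒪_v·1` which is `𝒪_v`-linear (`φ (c • q) = c • φ q`) is
multiplication by an element `c₀ ∈ 𝒪_v`: with a uniformiser `ϖ`, the elements `cₙ := ϖⁿ·φ(ϖ⁻ⁿ) ∈ 𝒪_v` are compatible modulo `ϖⁿ` and converge
`𝔪`-adically (`IsAdicComplete`, tree `AdicCompletionHensel`) to `c₀`, and `φ(a ϖ⁻ⁿ) = a φ(ϖ⁻ⁿ) ≡ c₀ a ϖ⁻ⁿ`.  (Rank-one Matlis duality; used in T-2 to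
recognise every `𝒪_v`-linear endomorphism of `W_K[p^∞] ≅ K_v/𝒪_v` as a formal-module scalar `u_b`.)
[cite: SerreLocalFields1979, Ch. II §1] -/
theorem exists_eq_smul_of_linear
    (φ : (v.adicCompletion K ⧸ Submodule.span (v.adicCompletionIntegers K) {(1 : v.adicCompletion K)}) →+
      (v.adicCompletion K ⧸ Submodule.span (v.adicCompletionIntegers K) {(1 : v.adicCompletion K)}))
    (hφ : ∀ (c : v.adicCompletionIntegers K)
      (q : v.adicCompletion K ⧸ Submodule.span (v.adicCompletionIntegers K) {(1 : v.adicCompletion K)}), φ (c • q) = c • φ q) :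
    ∃ c₀ : v.adicCompletionIntegers K,
      ∀ q : v.adicCompletion K ⧸ Submodule.span (v.adicCompletionIntegers K) {(1 : v.adicCompletion K)}, φ q = c₀ • q := by
  obtain ⟨ϖ, hϖ⟩ := IsDiscreteValuationRing.exists_irreducible (v.adicCompletionIntegers K)
  have hϖ0 : (ϖ : v.adicCompletion K) ≠ 0 := fun h ↦ hϖ.ne_zero (Subtype.ext h)
  have hmax : IsLocalRing.maximalIdeal (v.adicCompletionIntegers K) = Ideal.span {ϖ} := hϖ.maximalIdeal_eq
  -- the test elements `ϖ⁻ⁿ` and lifts `yₙ` of their images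
  set x : ℕ → v.adicCompletion K := fun n ↦ ((ϖ : v.adicCompletion K)⁻¹) ^ n with hx
  have hy : ∀ n, ∃ y : v.adicCompletion K,
      φ (Submodule.Quotient.mk (x n)) = Submodule.Quotient.mk y := fun n ↦ by
    obtain ⟨y, hy⟩ := Submodule.Quotient.mk_surjective _ (φ (Submodule.Quotient.mk (x n)))
    exact ⟨y, hy.symm⟩
  choose y hy using hy
  -- (1) `ϖⁿ • ϖ⁻ⁿ = 1 ≡ 0`
  have hkill : ∀ n, (ϖ ^ n : v.adicCompletionIntegers K) •
      (Submodule.Quotient.mk (x n) : v.adicCompletion K ⧸ Submodule.span (v.adicCompletionIntegers K) {(1 : v.adicCompletion K)}) = 0 := by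
    intro n
    rw [← Submodule.Quotient.mk_smul, (Submodule.Quotient.mk_eq_zero _).mpr]
    rw [mem_span_adicCompletionIntegers_one_iff, Algebra.smul_def, hx]
    change ((ϖ ^ n : v.adicCompletionIntegers K) : v.adicCompletion K) * ((ϖ : v.adicCompletion K)⁻¹) ^ n ∈ v.adicCompletionIntegers K
    push_cast
    rw [← mul_pow, mul_inv_cancel₀ hϖ0, one_pow]
    exact one_mem _
  -- (2) `cₙ := ϖⁿ yₙ ∈ 𝒪_v`
  have hc : ∀ n, ∃ c : v.adicCompletionIntegers K, (c : v.adicCompletion K) = (ϖ : v.adicCompletion K) ^ n * y n := by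
    intro n
    have h0 : (ϖ ^ n : v.adicCompletionIntegers K) •
        (Submodule.Quotient.mk (y n) : v.adicCompletion K ⧸ Submodule.span (v.adicCompletionIntegers K) {(1 : v.adicCompletion K)}) = 0 := by
      rw [← hy n, ← hφ, hkill n, map_zero]
    rw [← Submodule.Quotient.mk_smul, Submodule.Quotient.mk_eq_zero, mem_span_adicCompletionIntegers_one_iff, Algebra.smul_def] at h0
    exact ⟨⟨_, h0⟩, by push_cast; rfl⟩
  choose c hc using hc
  -- (3) `ϖ • ϖ^{-(n+1)} = ϖ^{-n}`
  have hstep : ∀ n, (ϖ : v.adicCompletionIntegers K) •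
      (Submodule.Quotient.mk (x (n + 1)) : v.adicCompletion K ⧸ Submodule.span (v.adicCompletionIntegers K) {(1 : v.adicCompletion K)}) =
        Submodule.Quotient.mk (x n) := by
    intro n
    rw [← Submodule.Quotient.mk_smul, Algebra.smul_def, hx]
    change Submodule.Quotient.mk ((ϖ : v.adicCompletion K) * ((ϖ : v.adicCompletion K)⁻¹) ^ (n + 1)) = _
    rw [pow_succ', ← mul_assoc, mul_inv_cancel₀ hϖ0, one_mul]
  -- (4) `c_{n+1} − cₙ ∈ ϖⁿ 𝒪_v`
  have hdiff : ∀ n, ∃ d : v.adicCompletionIntegers K, c (n + 1) - c n = ϖ ^ n * d := by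
    intro n
    have h1 : (ϖ : v.adicCompletionIntegers K) •
        (Submodule.Quotient.mk (y (n + 1)) : v.adicCompletion K ⧸ Submodule.span (v.adicCompletionIntegers K) {(1 : v.adicCompletion K)}) =
          Submodule.Quotient.mk (y n) := by
      rw [← hy (n + 1), ← hφ, hstep n, hy n]
    rw [← Submodule.Quotient.mk_smul, Submodule.Quotient.eq, mem_span_adicCompletionIntegers_one_iff, Algebra.smul_def] at h1
    refine ⟨⟨_, h1⟩, Subtype.ext ?_⟩
    push_cast
    rw [hc (n + 1), hc n]
    change _ = (ϖ : v.adicCompletion K) ^ n * ((ϖ : v.adicCompletion K) * y (n + 1) - y n)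
    ring
  choose d hd using hdiff
  -- (5) `(cₙ)` is Cauchy for the `𝔪`-adic filtration
  have hcauchy : ∀ {m n : ℕ}, m ≤ n → c m ≡ c n
      [SMOD (IsLocalRing.maximalIdeal (v.adicCompletionIntegers K) ^ m • ⊤ : Submodule (v.adicCompletionIntegers K) (v.adicCompletionIntegers K))] := by
    intro m n hmn
    obtain ⟨k, rfl⟩ := Nat.exists_eq_add_of_le hmn
    rw [SModEq.sub_mem, smul_eq_mul, Ideal.mul_top, hmax, Ideal.span_singleton_pow, Ideal.mem_span_singleton]
    induction k with
    | zero => simp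
    | succ k ih =>
        obtain ⟨e, he⟩ := ih (Nat.le_add_right m k)
        refine ⟨e - ϖ ^ k * d (m + k), ?_⟩
        have h2 : c m - c (m + (k + 1)) = (c m - c (m + k)) - (c (m + k + 1) - c (m + k)) := by rw [← add_assoc]; ring
        rw [h2, hd (m + k), he]
        ring
  -- (6) the limit `c₀`
  obtain ⟨c₀, hc₀⟩ := IsPrecomplete.prec' c hcauchy
  have hlim : ∀ n, ∃ e : v.adicCompletionIntegers K, c n - c₀ = ϖ ^ n * e := by
    intro n
    have h := hc₀ n
    rw [SModEq.sub_mem, smul_eq_mul, Ideal.mul_top, hmax, Ideal.span_singleton_pow, Ideal.mem_span_singleton] at h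
    exact h
  -- (7) `φ = c₀ •`
  refine ⟨c₀, fun q ↦ ?_⟩
  obtain ⟨z, rfl⟩ := Submodule.Quotient.mk_surjective _ q
  obtain ⟨n, a, rfl⟩ := exists_eq_mul_inv_pow v hϖ z
  obtain ⟨e, he⟩ := hlim n
  have hq : (Submodule.Quotient.mk ((a : v.adicCompletion K) * ((ϖ : v.adicCompletion K)⁻¹) ^ n) :
      v.adicCompletion K ⧸ Submodule.span (v.adicCompletionIntegers K) {(1 : v.adicCompletion K)}) = a • Submodule.Quotient.mk (x n) := by
    rw [← Submodule.Quotient.mk_smul, Algebra.smul_def]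
    rfl
  rw [hq, hφ, hy n, ← mul_smul, ← Submodule.Quotient.mk_smul, ← Submodule.Quotient.mk_smul, Submodule.Quotient.eq,
    mem_span_adicCompletionIntegers_one_iff, Algebra.smul_def, Algebra.smul_def]
  have hce : (c₀ : v.adicCompletion K) = (ϖ : v.adicCompletion K) ^ n * y n - (ϖ : v.adicCompletion K) ^ n * e := by
    rw [← hc n]
    have h := congrArg (fun t : v.adicCompletionIntegers K ↦ (t : v.adicCompletion K)) he
    push_cast at h
    linear_combination -h
  have key : (algebraMap (v.adicCompletionIntegers K) (v.adicCompletion K) a) * y n -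
      (algebraMap (v.adicCompletionIntegers K) (v.adicCompletion K) (c₀ * a)) * x n =
        ((a * e : v.adicCompletionIntegers K) : v.adicCompletion K) := by
    change (a : v.adicCompletion K) * y n - ((c₀ * a : v.adicCompletionIntegers K) : v.adicCompletion K) * ((ϖ : v.adicCompletion K)⁻¹) ^ n = _
    push_cast
    rw [hce]
    have hϖn : (ϖ : v.adicCompletion K) ^ n * ((ϖ : v.adicCompletion K)⁻¹) ^ n = 1 := by
      rw [← mul_pow, mul_inv_cancel₀ hϖ0, one_pow]
    linear_combination ((a : v.adicCompletion K) * (e : v.adicCompletion K) - (a : v.adicCompletion K) * y n) * hϖn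
  rw [key]
  exact (a * e).2

end DivisibleEnd

end Summit.BirchSwinnertonDyer.BirchSwinnertonDyer.Theorems.SmallImageRttCharRoad

end
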